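import Literature.AlgebraicGeometry.Resolution.AlterationsLemma411Blowup
import Literature.AlgebraicGeometry.Resolution.AlterationsLemma411SmoothLocus
import Literature.AlgebraicGeometry.Motives.VarietiesDimensionProofs
import Literature.AlgebraicGeometry.Motives.VarietiesProjectiveSpaceProofs
import Literature.Topology.KrullDimensionDrop
import Mathlib.AlgebraicGeometry.ZariskisMainTheorem
import HarnessLib

/-!
# De Jong's alteration theorem, proof of Lemma 4.11: the fibres of `f` are curves

Topic: `Literature/AlgebraicGeometry/Resolution`. DISCHARGES the named fact
`DeJong1996Lemma411FibreDimension` of `AlterationsLemma411Projection.lean` — Lemma 4.11 (ii) a)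
of de Jong 1996 ("All fibres of `f` are equidimensional of dimension 1 and nonempty") for the
construction `X' = X ×_{ℙ^{d+1}} P̃`, `f = pr₂ ≫ q`:

> "The fibres of the morphism `f = pr₂ : X' → ℙ^{d-1}` are the schemes `π⁻¹(ℓ)` […]. Since
> `π⁻¹(ℓ) → ℓ` is finite, we see that `π⁻¹(ℓ)` has dimension at most 1. On the other hand, `ℓ`
> is given locally by `d - 1` equations, hence `π⁻¹(ℓ)` has at every point dimension at least
> 1, as `X` has pure dimension `d`." (p. 68)

The upper bound is the printed one (the fibre `f⁻¹(y) → q⁻¹(y)` of `pr₂` is finite, a base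
change of `π`, and `dim q⁻¹(y) ≤ 1`). For the lower bound we do not count equations but use
Zariski's Main Theorem in Grothendieck's form (Mathlib `Scheme.Hom.isOpen_quasiFiniteAt`: the
quasi-finite locus of a morphism locally of finite type is open): an irreducible component of
dimension `0` of a fibre is an isolated point of its fibre, i.e. a point at which `f` is
quasi-finite; the quasi-finite locus would then be a non-empty open subset of the integral
`(d+1)`-dimensional `X'` (a blowing up of `X`, by `AlterationsLemma411Blowup.lean`), of dimension
`d + 1`, mapping with discrete fibres to the `d`-dimensional `ℙ^d` — impossible by
incomparability.

* `subsingleton_of_topologicalKrullDim_le_zero` — an irreducible closed subset of dimension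
  `≤ 0` of a sober `T₀` space is a point; `isOpen_of_mem_irreducibleComponents_of_le_zero` — in a
  Noetherian sober `T₀` space an irreducible component of dimension `≤ 0` is an open point;
  `eq_one_of_le_one_of_not_le_zero` — bookkeeping in `WithBot ℕ∞`;
* `quasiFiniteAt_of_isOpen_singleton` — a point open in its fibre is a quasi-finite point
  (Mathlib's `quasiFiniteAt_iff_isOpen_singleton_asFiber`, transported to `f⁻¹(y) ⊆ X`);
* `topologicalKrullDim_fiber_le` — `dim f⁻¹(y) ≤ dim q⁻¹(y)` for `f = pr₂ ≫ q`, `pr₂` finite;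
* `DeJong1996Lemma411FibreDimension_holds` — the named fact DISCHARGED;
* `DeJong1996Lemma411.of_genericProjection` — with (i) (`AlterationsLemma411Blowup.lean`) and
  (ii) b) (`AlterationsLemma411SmoothLocus.lean`) also discharged, **Lemma 4.11 now rests on the
  single named fact `DeJong1996Lemma411GenericProjection`** (the generic choice of `π`, `p`:
  2.11, (ii) c), Bertini); rewired down to `DeJong1996FibrationReduction` and
  `DeJong1996StrongAlgClosed`.

## Sources

* A. J. de Jong, *Smoothness, semi-stability and alterations*, Publ. Math. IHÉS 83 (1996),
  Lemma 4.11 (ii) a) and its proof, pp. 67–68. [DeJong1996]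
* A. Grothendieck, EGA IV₃ (1966), Thm. 8.12.6 / Cor. 13.1.4 (Zariski's Main Theorem; openness
  of the quasi-finite locus); The Stacks Project, Tag 01TI.
-/

noncomputable section

open CategoryTheory CategoryTheory.Limits AlgebraicGeometry TopologicalSpace Topology

namespace Literature.AlgebraicGeometry.Resolution

universe u

/-! ## Topology: irreducible closed subsets of dimension zero -/

/-- **An irreducible closed subset of dimension `≤ 0` of a sober `T₀` space is a single point**:
every irreducible closed subset of it is maximal (`Order.krullDim_nonpos_iff_forall_isMax`), so
the closure of each of its points is everything, and each point is generic. [folklore] -/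
theorem subsingleton_of_topologicalKrullDim_le_zero {α : Type*} [TopologicalSpace α]
    [QuasiSober α] [T0Space α] {C : Set α} (hC : IsIrreducible C) (hCcl : IsClosed C)
    (h0 : topologicalKrullDim C ≤ 0) : C.Subsingleton := by
  haveI : QuasiSober C := Literature.Topology.quasiSober_of_isClosed hCcl
  haveI : IrreducibleSpace C := Subtype.irreducibleSpace hC
  have hmax := Order.krullDim_nonpos_iff_forall_isMax.mp h0
  have key : ∀ c : C, genericPoint C ∈ closure ({c} : Set C) := by
    intro c
    let A : IrreducibleCloseds C :=
      ⟨closure {c}, isIrreducible_singleton.closure, isClosed_closure⟩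
    let B : IrreducibleCloseds C :=
      ⟨Set.univ, IrreducibleSpace.isIrreducible_univ C, isClosed_univ⟩
    have hAB : A ≤ B := fun x _ => Set.mem_univ x
    have hBA : B ≤ A := hmax A hAB
    exact hBA (Set.mem_univ (genericPoint C))
  have hspec : ∀ c : C, c = genericPoint C := fun c =>
    ((specializes_iff_mem_closure.mpr (key c)).antisymm
      ((genericPoint_spec C).specializes (Set.mem_univ c))).eq
  intro a ha b hb
  exact congrArg Subtype.val ((hspec ⟨a, ha⟩).trans (hspec ⟨b, hb⟩).symm)

/-- **An irreducible component of dimension `≤ 0` of a Noetherian sober `T₀` space is an open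
point**: it is a point (`subsingleton_of_topologicalKrullDim_le_zero`) lying in no other of the
finitely many components, i.e. the complement of their (closed) union. [folklore] -/
theorem isOpen_of_mem_irreducibleComponents_of_le_zero {α : Type*} [TopologicalSpace α]
    [QuasiSober α] [T0Space α] [NoetherianSpace α] {C : Set α}
    (hC : C ∈ irreducibleComponents α) (h0 : topologicalKrullDim C ≤ 0) : IsOpen C := by
  have hsub := subsingleton_of_topologicalKrullDim_le_zero hC.1
    (isClosed_of_mem_irreducibleComponents C hC) h0
  have heq : C = (⋃₀ (irreducibleComponents α \ {C}))ᶜ := by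
    apply Set.Subset.antisymm
    · rintro x hx ⟨C', ⟨hC', hne⟩, hxC'⟩
      apply hne
      have hCC' : C ⊆ C' := fun z hz => (hsub hz hx) ▸ hxC'
      exact Set.Subset.antisymm (hC.2 hC'.1 hCC') hCC'
    · intro x hx
      by_contra hxC
      exact hx ⟨irreducibleComponent x, ⟨irreducibleComponent_mem_irreducibleComponents x,
        fun h => hxC (h ▸ mem_irreducibleComponent)⟩, mem_irreducibleComponent⟩
  rw [heq, isOpen_compl_iff, Set.sUnion_eq_biUnion]
  exact (NoetherianSpace.finite_irreducibleComponents.subset Set.sdiff_subset).isClosed_biUnion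
    fun C' hC' => isClosed_of_mem_irreducibleComponents C' hC'.1

/-- Bookkeeping in `WithBot ℕ∞`: a dimension `≤ 1` which is not `≤ 0` equals `1`. [folklore] -/
theorem eq_one_of_le_one_of_not_le_zero {a : WithBot ℕ∞} (h1 : a ≤ 1) (h0 : ¬a ≤ 0) : a = 1 := by
  induction a using WithBot.recBotCoe with
  | bot => exact absurd bot_le h0
  | coe m =>
    induction m using ENat.recTopCoe with
    | top =>
      have : ((⊤ : ℕ∞) : WithBot ℕ∞) ≤ ((1 : ℕ∞) : WithBot ℕ∞) := h1
      exact absurd (WithBot.coe_le_coe.mp this) (by simp)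
    | coe n =>
      have h1' : n ≤ 1 := by
        have : ((n : ℕ∞) : WithBot ℕ∞) ≤ ((1 : ℕ∞) : WithBot ℕ∞) := h1
        exact_mod_cast WithBot.coe_le_coe.mp this
      have h0' : ¬n ≤ 0 := by
        intro hn
        apply h0
        have : ((n : ℕ∞) : WithBot ℕ∞) ≤ ((0 : ℕ∞) : WithBot ℕ∞) := by exact_mod_cast hn
        exact this
      have : n = 1 := by omega
      subst this
      rfl

/-! ## A point open in its fibre is a quasi-finite point -/

/-- **A point which is open in its fibre is a quasi-finite point** of a morphism locally of
finite type (Mathlib's `Scheme.Hom.quasiFiniteAt_iff_isOpen_singleton_asFiber`, transported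
from the scheme-theoretic fibre to the subspace `f⁻¹(f x) ⊆ X`). [folklore] -/
theorem quasiFiniteAt_of_isOpen_singleton {X Y : Scheme.{u}} (f : X ⟶ Y) [LocallyOfFiniteType f]
    (x : X) (h : IsOpen ({⟨x, rfl⟩} : Set (f ⁻¹' {f x}))) : f.QuasiFiniteAt x := by
  rw [Scheme.Hom.quasiFiniteAt_iff_isOpen_singleton_asFiber,
    ← (f.fiberHomeo (f x)).isOpen_image, Set.image_singleton]
  convert h using 2
  apply Subtype.ext
  rw [Scheme.Hom.fiberHomeo_apply, Scheme.Hom.fiberι_asFiber]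

/-- If a point `c` of the scheme-theoretic fibre `f⁻¹(y)` is open in it, then `f` is
quasi-finite at its image `x ∈ X` (the fibre embeds homeomorphically onto `f⁻¹(y) ⊆ X`, and
`y = f x`). [folklore] -/
theorem quasiFiniteAt_fiberι_of_isOpen_singleton {X Y : Scheme.{u}} (f : X ⟶ Y)
    [LocallyOfFiniteType f] {y : Y} (c : ↥(f.fiber y)) (h : IsOpen ({c} : Set ↥(f.fiber y))) :
    f.QuasiFiniteAt (f.fiberι y c) := by
  have hx : f (f.fiberι y c) = y := by
    have : f.fiberι y c ∈ Set.range (f.fiberι y) := ⟨c, rfl⟩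
    rw [Scheme.Hom.range_fiberι] at this
    exact this
  -- openness of the corresponding point of the subspace `f⁻¹(y)`
  have h1 : IsOpen ({f.fiberHomeo y c} : Set (f ⁻¹' {y})) := by
    rw [← Set.image_singleton, (f.fiberHomeo y).isOpen_image]
    exact h
  have h2 : (f.fiberHomeo y c : f ⁻¹' {y}) = ⟨f.fiberι y c, hx⟩ :=
    Subtype.ext (Scheme.Hom.fiberHomeo_apply f y c)
  rw [h2] at h1
  -- transport along `y = f x`
  have key : ∀ (x : X) (hx : f x = y), IsOpen ({⟨x, hx⟩} : Set (f ⁻¹' {y})) →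
      IsOpen ({⟨x, rfl⟩} : Set (f ⁻¹' {f x})) := by
    intro x hx hopen
    subst hx
    exact hopen
  exact quasiFiniteAt_of_isOpen_singleton f _ (key _ hx h1)

/-! ## The fibres of `f = pr₂ ≫ q` over those of `q` -/

section Construction

variable {X T P B : Scheme.{u}} (π : X ⟶ T) (b : P ⟶ T) (q : P ⟶ B)

/-- **"Since `π⁻¹(ℓ) → ℓ` is finite, `π⁻¹(ℓ)` has dimension at most" `dim ℓ`**: for
`X' = X ×_T P`, `f = pr₂ ≫ q` with `π` finite, the fibre `f⁻¹(y)` maps to `q⁻¹(y)` by a base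
change of the finite `pr₂`, so `dim f⁻¹(y) ≤ dim q⁻¹(y)` (incomparability along finite
morphisms). [cite: DeJong1996, Lemma 4.11 (proof), p. 68] -/
theorem topologicalKrullDim_fiber_le [IsFinite π] (y : B) :
    topologicalKrullDim ↥((pullback.snd π b ≫ q).fiber y) ≤ topologicalKrullDim ↥(q.fiber y) := by
  set π' := pullback.snd π b with hπ'
  set f := π' ≫ q with hf
  let g : f.fiber y ⟶ q.fiber y :=
    pullback.lift (f.fiberι y ≫ π') (f.fiberToSpecResidueField y)
      (by rw [Category.assoc, ← hf, Scheme.Hom.fiber_fac])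
  have hg₁ : g ≫ q.fiberι y = f.fiberι y ≫ π' := pullback.lift_fst _ _ _
  have hg₂ : g ≫ q.fiberToSpecResidueField y = f.fiberToSpecResidueField y :=
    pullback.lift_snd _ _ _
  have s0 : IsPullback (f.fiberι y) (f.fiberToSpecResidueField y) f
      (B.fromSpecResidueField y) := IsPullback.of_hasPullback _ _
  have t0 : IsPullback (q.fiberι y) (q.fiberToSpecResidueField y) q
      (B.fromSpecResidueField y) := IsPullback.of_hasPullback _ _
  have s : IsPullback (g ≫ q.fiberToSpecResidueField y) (f.fiberι y)
      (B.fromSpecResidueField y) (π' ≫ q) := by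
    rw [hg₂]
    exact s0.flip
  have sq : IsPullback g (f.fiberι y) (q.fiberι y) π' := IsPullback.of_right s hg₁ t0.flip
  haveI : IsFinite g := MorphismProperty.of_isPullback (P := @IsFinite) sq.flip inferInstance
  exact Literature.AlgebraicGeometry.Motives.Scheme.topologicalKrullDim_le_of_locallyQuasiFinite g

end Construction

/-! ## (ii) a) discharged -/

open Literature.AlgebraicGeometry.Motives (projectiveSpace IsProjectiveOver) in
/-- **`DeJong1996Lemma411FibreDimension` DISCHARGED** (de Jong 1996, Lemma 4.11 (ii) a) for
`X' = X ×_{ℙ^{d+1}} P̃`, `f = pr₂ ≫ q`). Surjectivity: `pr₂` is a base change of the surjective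
`π`, and every fibre of `q` is met by `E`. Upper bound `≤ 1`: `topologicalKrullDim_fiber_le` and
`dim q⁻¹(y) ≤ 1`. Lower bound: `X'` is integral of dimension `d + 1` (the blowing up of `X` in
`π⁻¹(p)`, `isBlowup_fst_vanishingIdeal_preimage`, `IsAlteration.topologicalKrullDim_eq`); a
component of dimension `0` of a fibre would be an open point of it
(`isOpen_of_mem_irreducibleComponents_of_le_zero`), hence a quasi-finite point of `f`
(`quasiFiniteAt_fiberι_of_isOpen_singleton`); but the quasi-finite locus of `f` is open
(Zariski's Main Theorem, Mathlib `Scheme.Hom.quasiFiniteLocus`) and `f` is locally quasi-finite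
on it, so it has dimension both `d + 1` (a non-empty open of `X'`) and `≤ dim ℙ^d_k = d`.
[cite: DeJong1996, Lemma 4.11 (ii) a) and proof, pp. 67–68] -/
theorem DeJong1996Lemma411FibreDimension_holds : DeJong1996Lemma411FibreDimension.{u} := by
  intro k _ _ X fX Z d π p P b q _ hX hdim hπ hM
  obtain ⟨V, hpV, hV⟩ := hπ.exists_etale_morphismRestrict
  haveI := hV
  haveI := hπ.isFinite
  haveI := hπ.surjective
  haveI := hM.smooth
  have hp := hM.isClosed_singleton
  -- standing instances
  haveI : IsProper (projectiveSpace (d + 1) k).hom :=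
    Literature.AlgebraicGeometry.Motives.isProper_projectiveSpace (d + 1) k
  haveI : IsProper (projectiveSpace d k).hom :=
    Literature.AlgebraicGeometry.Motives.isProper_projectiveSpace d k
  haveI : IsProper fX :=
    Literature.AlgebraicGeometry.Motives.IsProjectiveOver.isProper (X := Over.mk fX) hX
  haveI : IsLocallyNoetherian (projectiveSpace (d + 1) k).left :=
    LocallyOfFiniteType.isLocallyNoetherian (projectiveSpace (d + 1) k).hom
  haveI : IsLocallyNoetherian X := LocallyOfFiniteType.isLocallyNoetherian fX
  haveI : IsProper b := hM.isBlowup.isProper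
  haveI : IsLocallyNoetherian P := LocallyOfFiniteType.isLocallyNoetherian b
  haveI : QuasiCompact (q ≫ (projectiveSpace d k).hom) := by
    rw [hM.comp_hom]
    infer_instance
  haveI : QuasiCompact q := QuasiCompact.of_comp q (projectiveSpace d k).hom
  set φ := pullback.fst π b with hφ
  set π' := pullback.snd π b with hπ'
  set f := π' ≫ q with hf
  -- surjectivity
  haveI : Surjective q := ⟨fun y => by
    obtain ⟨e, -, he⟩ := hM.exists_apply_eq y
    exact ⟨e, he⟩⟩
  haveI hsurj : Surjective f := inferInstance
  refine ⟨hsurj, fun y C hC => ?_⟩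
  -- `X'` is integral of dimension `d + 1`
  have h1X : (1 : WithBot ℕ∞) ≤ topologicalKrullDim X := by
    rw [hdim]
    exact_mod_cast Nat.succ_le_succ (Nat.zero_le d)
  have hS : IsClosed (π ⁻¹' {p}) := hp.preimage π.continuous
  have hJ := vanishingIdeal_ne_bot_of_forall_isClosed h1X hS
    (fun s hs => isClosed_singleton_of_mem_preimage π hp hs)
  have hblow := isBlowup_fst_vanishingIdeal_preimage π b hp hM.isBlowup V hpV
  haveI : IsIntegral (pullback π b) := hblow.isIntegral hJ
  have hφalt : IsAlteration φ := isAlteration_of_isBlowup hblow hJ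
  have hdimX' : topologicalKrullDim ↥(pullback π b) = (d + 1 : ℕ) := by
    rw [hφalt.topologicalKrullDim_eq fX, hdim]
  -- upper bound
  have hle1 : topologicalKrullDim C ≤ 1 :=
    (topologicalKrullDim_subspace_le _ C).trans
      ((topologicalKrullDim_fiber_le π b q y).trans (hM.topologicalKrullDim_fiber_le_one y))
  refine eq_one_of_le_one_of_not_le_zero hle1 fun h0 => ?_
  -- lower bound: a component of dimension `0` is an open point of the fibre …
  haveI : LocallyOfFiniteType (f.fiberToSpecResidueField y) := by
    delta Scheme.Hom.fiberToSpecResidueField Scheme.Hom.fiber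
    infer_instance
  haveI : IsLocallyNoetherian (f.fiber y) :=
    LocallyOfFiniteType.isLocallyNoetherian (f.fiberToSpecResidueField y)
  haveI : IsNoetherian (f.fiber y) := {}
  have hopen : IsOpen C := isOpen_of_mem_irreducibleComponents_of_le_zero hC h0
  have hsub := subsingleton_of_topologicalKrullDim_le_zero hC.1
    (isClosed_of_mem_irreducibleComponents C hC) h0
  obtain ⟨c, hc⟩ := hC.1.nonempty
  have hCc : C = {c} := hsub.eq_singleton_of_mem hc
  rw [hCc] at hopen
  -- … hence a quasi-finite point of `f`
  have hqf : f.QuasiFiniteAt (f.fiberι y c) := quasiFiniteAt_fiberι_of_isOpen_singleton f c hopen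
  -- the quasi-finite locus `W` is a non-empty open of `X'`, of dimension `d + 1` and `≤ d`
  haveI : Nonempty (f.quasiFiniteLocus : Scheme.{u}) := ⟨(⟨f.fiberι y c, hqf⟩ : f.quasiFiniteLocus)⟩
  have hW : topologicalKrullDim ↥(f.quasiFiniteLocus) = (d + 1 : ℕ) := by
    rw [← hdimX']
    exact topologicalKrullDim_eq_of_isOpenImmersion (φ ≫ fX) f.quasiFiniteLocus.ι
  have hWle : topologicalKrullDim ↥(f.quasiFiniteLocus) ≤
      topologicalKrullDim ↥(projectiveSpace d k).left :=
    Literature.AlgebraicGeometry.Motives.Scheme.topologicalKrullDim_le_of_locallyQuasiFinite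
      (f.quasiFiniteLocus.ι ≫ f)
  haveI : SmoothOfRelativeDimension d (projectiveSpace d k).hom :=
    (Literature.AlgebraicGeometry.Motives.isSmoothProjective_projectiveSpace_holds k d)
      |>.smoothOfRelativeDimension
  haveI := isIntegral_projectiveSpace (n := d) (k := k)
  have hPd : topologicalKrullDim ↥(projectiveSpace d k).left = (d : ℕ) :=
    Literature.AlgebraicGeometry.Motives.topologicalKrullDim_eq_of_smoothOfRelativeDimension
      (projectiveSpace d k).hom d
  rw [hW, hPd] at hWle
  have : d + 1 ≤ d := by
    have h' : ((d + 1 : ℕ) : WithBot ℕ∞) ≤ ((d : ℕ) : WithBot ℕ∞) := hWle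
    exact_mod_cast h'
  omega

/-! ## Lemma 4.11 from the generic projection alone -/

/-- **de Jong 1996, Lemma 4.11 from the generic choice of `π` and `p` alone**: the three
construction steps (i), (ii) a), (ii) b) being discharged (`DeJong1996Lemma411Blowup_holds`,
`DeJong1996Lemma411FibreDimension_holds`, `DeJong1996Lemma411SmoothLocusDense_holds`),
`DeJong1996Lemma411` follows from `DeJong1996Lemma411GenericProjection`.
[cite: DeJong1996, Lemma 4.11 and its proof, pp. 67–68] -/
theorem DeJong1996Lemma411.of_genericProjection (hA : DeJong1996Lemma411GenericProjection.{u}) :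
    DeJong1996Lemma411.{u} :=
  DeJong1996Lemma411.of_genericProjection_of_construction hA DeJong1996Lemma411Blowup_holds
    DeJong1996Lemma411FibreDimension_holds DeJong1996Lemma411SmoothLocusDense_holds

/-- `DeJong1996FibrationReduction` (4.11 with 4.12) from the generic projection fact, the two
inputs of 4.12 and the projectivity of blowing ups. [cite: DeJong1996, 4.11–4.12, pp. 67–69] -/
theorem DeJong1996FibrationReduction.of_genericProjection (hB : BlowupProjectiveOverField.{u})
    (hA : DeJong1996Lemma411GenericProjection.{u}) (h28 : DeJong1996SmoothOverOpen.{u})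
    (hc : DeJong1996FibresGeometricallyConnected.{u}) : DeJong1996FibrationReduction.{u} :=
  DeJong1996FibrationReduction.of_lemma411 hB (DeJong1996Lemma411.of_genericProjection hA) h28 hc

/-- **Thm. 4.1 with its generically-étale clause over algebraically closed fields** from the
projectivity of blowing ups, the generic projection fact (all that is left of Lemma 4.11), the
two inputs of 4.12 and 4.13–4.28. [cite: DeJong1996, 4.3–4.12, pp. 66–69] -/
theorem DeJong1996StrongAlgClosed.of_blowupProjective_of_genericProjection_of_stepVI
    (hB : BlowupProjectiveOverField.{u}) (hA : DeJong1996Lemma411GenericProjection.{u})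
    (h28 : DeJong1996SmoothOverOpen.{u}) (hc : DeJong1996FibresGeometricallyConnected.{u})
    (h₂ : DeJong1996NormalProjectiveStepVI.{u}) : DeJong1996StrongAlgClosed.{u} :=
  DeJong1996StrongAlgClosed.of_blowupProjective_of_lemma411_of_stepVI hB
    (DeJong1996Lemma411.of_genericProjection hA) h28 hc h₂

end Literature.AlgebraicGeometry.Resolution

end
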